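import Summits.ValiantsHypothesis.ValiantsHypothesis.Theorems.ValuativeGCTValuativeFlipTwistPositivityForm
import HarnessLib

/-!
# Twist positivity, II: the dimension inequality `dim (HWV ∩ tw⁻¹ I) ≤ dim (HWV ∩ I)`
(crux `ValuativeGCT.ValuativeFlip`, stmt-ValiantsHypothesis-12624; wall-breaker k12 gen 1, axis
"representation-stability transfer between `m` and `m + 1`"; helper file `--supports`; part I is
`…TwistPositivityForm.lean`)

**Theorem (`tp_finrank_inf_comap_twist_le`, registered stub).**  For any polynomial `f`, `I = I(GL·f) ⊆ ℂ[Sym^n]`,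
`H` = the highest-weight vectors of weight `χ` among forms of degree `d`, and `tw = aeval (e ↦ a_e X_e)` a
rescaling by POSITIVE integers: `dim (H ∩ tw⁻¹ I) ≤ dim (H ∩ I)`.
Proof (5 steps, all inside one finite-dimensional piece `S_d`): `C := (I ∩ S_d)^⊥ ∩ S_d` for the word-model form
of part I is a `GL`-stable complement of `I ∩ S_d` (adjointness + positivity + a dimension count); hence every
`h ∈ H` splits as `m + c` with `m, c ∈ H` (equivariant projections), i.e. `dim H ≤ dim(H ∩ I) + dim(H ∩ C)`; and
`(H ∩ tw⁻¹ I) ∩ (H ∩ C) = 0` since `tw y ∈ I`, `y ∈ C` give `⟨tw y, y⟩ = 0`.  Consequences (part III,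
`…PerAnchorInheritanceEvery.lean`): BLMW 2011 Problem 6.10 "≥" for the padded permanent at EVERY padding, and the
same for every inner form / the det side.  Numerics that found the statement: this seat's `py/phi_ranks*.py`,
`py/submodule_test.py` (0 violations in 358 rays × 20 positive rescalings and 875 random `gl₂`-submodules).

Sources: BLMW 2011 §4.4, §5.2, §6.4 (Problem 6.10); Weyl's unitary trick; this seat's
`Cruxes/ValuativeFlip/TwistPositivityK12G1.md`. No new definitions.
-/

set_option linter.dupNamespace false

namespace Summit.ValiantsHypothesis.ValiantsHypothesis.Theorems.ValuativeFlip

open scoped BigOperators Matrix ComplexConjugate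
open MvPolynomial
open Literature.NumberTheory.DiophantineGeometry
open Literature.Computability.AlgebraicComplexity

noncomputable section


/-- **Twist positivity (the dimension inequality).**  Let `f` be any polynomial, `I = I(GL · f) ⊆ ℂ[Sym^n]`
its (G-stable) vanishing ideal, `H` the highest-weight vectors of weight `χ` among the forms of degree `d`,
and `tw = aeval (e ↦ a_e X_e)` a diagonal rescaling by POSITIVE integers `a_e` (e.g. the Kadish–Landsberg
twist `(e_top + j)!/e_top!`).  Then `dim (H ∩ tw⁻¹(I)) ≤ dim (H ∩ I)`: a positive rescaling of the ideal of a
`GL`-stable variety never contains more highest-weight vectors than the ideal itself.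
Proof: the word-model Hermitian form `⟨F, G⟩ = ∑_w conj(Φ F w) Φ G w` is positive definite on forms of degree
`d`, the action is adjointable (`tp_form_adjoint`), so `C = (I_d)^⊥` is a `GL`-stable complement of
`I_d = I ∩ ℂ[Sym^n]_d`, whence `H = (H ∩ I) ⊕ (H ∩ C)`; and `(H ∩ tw⁻¹ I) ∩ C = 0` because `y = ` with
`tw y ∈ I`, `y ∈ C` gives `⟨tw y, y⟩ = 0`, impossible for `y ≠ 0` (`tp_eq_zero_of_form_twist_eq_zero`).
[this crux; the unitary trick] -/
theorem tp_finrank_inf_comap_twist_le {σ : Type*} [Fintype σ] [LinearOrder σ] (f : MvPolynomial σ ℂ) (n d : ℕ)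
    (χ : Weight σ)
    (a : DegIdx σ n → ℕ) (ha : ∀ e, 0 < a e) :
    Module.finrank ℂ ↥((highestWeightSpace (coordRep σ ℂ n) χ ⊓ homogeneousSubmodule (DegIdx σ n) ℂ d) ⊓
        ((orbitVanishingIdeal f n).restrictScalars ℂ).comap
          (aeval (fun e => C ((a e : ℕ) : ℂ) * X e) :
            MvPolynomial (DegIdx σ n) ℂ →ₐ[ℂ] MvPolynomial (DegIdx σ n) ℂ).toLinearMap) ≤
      Module.finrank ℂ ↥((highestWeightSpace (coordRep σ ℂ n) χ ⊓ homogeneousSubmodule (DegIdx σ n) ℂ d) ⊓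
        (orbitVanishingIdeal f n).restrictScalars ℂ) := by
  classical
  -- an enumeration of the letters and the linear word map
  set Mσ := Fintype.card σ with hMσ
  let ρ : Fin Mσ ≃ σ := (Fintype.equivFin σ).symm
  obtain ⟨WL, hWL⟩ := tp_exists_wordOfFormLin ρ n d
  -- the spaces
  set S := MvPolynomial (DegIdx σ n) ℂ with hS
  set tw : MvPolynomial (DegIdx σ n) ℂ →ₐ[ℂ] MvPolynomial (DegIdx σ n) ℂ :=
    aeval (fun e => C ((a e : ℕ) : ℂ) * X e) with htw
  set Sd : Submodule ℂ (MvPolynomial (DegIdx σ n) ℂ) := homogeneousSubmodule (DegIdx σ n) ℂ d with hSd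
  set I : Submodule ℂ (MvPolynomial (DegIdx σ n) ℂ) := (orbitVanishingIdeal f n).restrictScalars ℂ with hI
  set HW : Submodule ℂ (MvPolynomial (DegIdx σ n) ℂ) := highestWeightSpace (coordRep σ ℂ n) χ with hHW
  set H : Submodule ℂ (MvPolynomial (DegIdx σ n) ℂ) := HW ⊓ Sd with hH
  set Mi : Submodule ℂ (MvPolynomial (DegIdx σ n) ℂ) := I ⊓ Sd with hMi
  -- finite-dimensionality of `Sd` and of everything below it
  have hSdle : Sd ≤ restrictTotalDegree (DegIdx σ n) ℂ d := by
    intro F hF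
    rw [mem_restrictTotalDegree]
    exact ((mem_homogeneousSubmodule d F).mp hF).totalDegree_le
  haveI hSdfin : FiniteDimensional ℂ ↥Sd := Submodule.finiteDimensional_of_le hSdle
  have hHle : H ≤ Sd := inf_le_right
  have hMile : Mi ≤ Sd := inf_le_right
  haveI : FiniteDimensional ℂ ↥H := Submodule.finiteDimensional_of_le hHle
  haveI : FiniteDimensional ℂ ↥Mi := Submodule.finiteDimensional_of_le hMile
  -- the form
  let B : S → S → ℂ := fun F G => ∑ w : Word Mσ (d * n), conj (WL F w) * WL G w
  have hB : ∀ F G, B F G = ∑ w : Word Mσ (d * n), conj (wordOfForm ρ n d F w) * wordOfForm ρ n d G w := by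
    intro F G; simp only [B, hWL]
  have hBadd : ∀ F G G', B F (G + G') = B F G + B F G' := by
    intro F G G'
    simp only [B, map_add, Pi.add_apply, mul_add, Finset.sum_add_distrib]
  have hBsmul : ∀ F (c : ℂ) G, B F (c • G) = c * B F G := by
    intro F c G
    simp only [B, map_smul, Pi.smul_apply, smul_eq_mul, Finset.mul_sum]
    exact Finset.sum_congr rfl fun w _ => by ring
  have hBadd_left : ∀ F F' G, B (F + F') G = B F G + B F' G := by
    intro F F' G
    simp only [B, map_add, Pi.add_apply, map_add, add_mul, Finset.sum_add_distrib]
  have hBsmul_left : ∀ (c : ℂ) F G, B (c • F) G = conj c * B F G := by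
    intro c F G
    simp only [B, map_smul, Pi.smul_apply, smul_eq_mul, map_mul, Finset.mul_sum]
    exact Finset.sum_congr rfl fun w _ => by ring
  -- positivity: `B (tw y) y = 0 → y = 0` and `B y y = 0 → y = 0` on forms of degree `d`
  have hpos : ∀ y ∈ Sd, B (tw y) y = 0 → y = 0 := by
    intro y hy h0
    rw [hB] at h0
    exact tp_eq_zero_of_form_twist_eq_zero ρ a ha ((mem_homogeneousSubmodule d y).mp hy) h0
  have hpos1 : ∀ y ∈ Sd, B y y = 0 → y = 0 := by
    intro y hy h0
    rw [hB] at h0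
    refine tp_eq_zero_of_form_twist_eq_zero ρ (fun _ => 1) (fun _ => Nat.one_pos)
      ((mem_homogeneousSubmodule d y).mp hy) ?_
    rw [tp_twist_one]
    exact h0
  -- the orthogonal complement `C` of `Mi` inside `Sd`
  let C : Submodule ℂ (MvPolynomial (DegIdx σ n) ℂ) :=
    { carrier := {y | y ∈ Sd ∧ ∀ m ∈ Mi, B m y = 0}
      add_mem' := by
        rintro y z ⟨hy, hy'⟩ ⟨hz, hz'⟩
        exact ⟨Sd.add_mem hy hz, fun m hm => by rw [hBadd, hy' m hm, hz' m hm, add_zero]⟩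
      zero_mem' := ⟨Sd.zero_mem, fun m hm => by
        have := hBsmul m 0 0; rw [zero_smul, zero_mul] at this; exact this⟩
      smul_mem' := by
        rintro c y ⟨hy, hy'⟩
        exact ⟨Sd.smul_mem c hy, fun m hm => by rw [hBsmul, hy' m hm, mul_zero]⟩ }
  have hCmem : ∀ {y}, y ∈ C ↔ y ∈ Sd ∧ ∀ m ∈ Mi, B m y = 0 := fun {y} => Iff.rfl
  have hCle : C ≤ Sd := fun y hy => (hCmem.mp hy).1
  haveI : FiniteDimensional ℂ ↥C := Submodule.finiteDimensional_of_le hCle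
  -- `Mi ⊓ C = ⊥`
  have hMiC : Mi ⊓ C = ⊥ := by
    rw [Submodule.eq_bot_iff]
    rintro y ⟨hyM, hyC⟩
    exact hpos1 y (hMile hyM) ((hCmem.mp hyC).2 y hyM)
  -- `dim C ≥ dim Sd - dim Mi`
  set r := Module.finrank ℂ ↥Mi with hr
  let bM := Module.finBasis ℂ ↥Mi
  obtain ⟨Bl, hBl⟩ : ∃ Bl : MvPolynomial (DegIdx σ n) ℂ → (MvPolynomial (DegIdx σ n) ℂ →ₗ[ℂ] ℂ),
      ∀ m y, Bl m y = B m y :=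
    ⟨fun m => { toFun := B m, map_add' := hBadd m, map_smul' := fun c y => hBsmul m c y }, fun _ _ => rfl⟩
  let Ψ : ↥Sd →ₗ[ℂ] (Fin r → ℂ) := (LinearMap.pi fun i : Fin r => Bl ((bM i : ↥Mi) : MvPolynomial (DegIdx σ n) ℂ)) ∘ₗ Sd.subtype
  have hΨker : (LinearMap.ker Ψ).map Sd.subtype ≤ C := by
    rintro _ ⟨y, hy, rfl⟩
    rw [SetLike.mem_coe, LinearMap.mem_ker] at hy
    refine hCmem.mpr ⟨y.2, fun m hm => ?_⟩
    -- expand `m` in the basis `bM`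
    have hrepr := bM.sum_repr ⟨m, hm⟩
    have hm' : m = ∑ i, (bM.repr ⟨m, hm⟩ i) • ((bM i : ↥Mi) : MvPolynomial (DegIdx σ n) ℂ) := by
      have := congrArg (fun x : ↥Mi => (x : MvPolynomial (DegIdx σ n) ℂ)) hrepr
      simp only [Submodule.coe_sum, Submodule.coe_smul] at this
      exact this.symm
    have hyi : ∀ i : Fin r, B ((bM i : ↥Mi) : MvPolynomial (DegIdx σ n) ℂ) y = 0 := fun i => by
      have := congrFun hy i
      simp only [Ψ, LinearMap.coe_comp, Function.comp_apply, LinearMap.pi_apply, Submodule.coe_subtype,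
        Pi.zero_apply, hBl] at this
      exact this
    rw [hm']
    have key : ∀ (T : Finset (Fin r)),
        B (∑ i ∈ T, (bM.repr ⟨m, hm⟩ i) • ((bM i : ↥Mi) : MvPolynomial (DegIdx σ n) ℂ)) (y : MvPolynomial (DegIdx σ n) ℂ) = 0 := by
      intro T
      induction T using Finset.induction_on with
      | empty =>
        rw [Finset.sum_empty]
        have := hBsmul_left 0 0 (y : MvPolynomial (DegIdx σ n) ℂ)
        rw [zero_smul, map_zero, zero_mul] at this
        exact this
      | insert i T hi ih => rw [Finset.sum_insert hi, hBadd_left, ih, hBsmul_left, hyi i, mul_zero, zero_add]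
    exact key Finset.univ
  have hdimC : Module.finrank ℂ ↥Sd ≤ Module.finrank ℂ ↥C + r := by
    have h1 := LinearMap.finrank_range_add_finrank_ker Ψ
    have h2 : Module.finrank ℂ ↥(LinearMap.range Ψ) ≤ r := by
      have := Submodule.finrank_le (LinearMap.range Ψ)
      rwa [Module.finrank_fin_fun] at this
    have h3 : Module.finrank ℂ ↥(LinearMap.ker Ψ) ≤ Module.finrank ℂ ↥C := by
      rw [← Submodule.finrank_map_subtype_eq Sd (LinearMap.ker Ψ)]
      exact Submodule.finrank_mono hΨker
    omega
  -- `Mi ⊔ C = Sd`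
  have hsup : Mi ⊔ C = Sd := by
    apply Submodule.eq_of_le_of_finrank_le (sup_le hMile hCle)
    have h := Submodule.finrank_sup_add_finrank_inf_eq Mi C
    rw [hMiC, finrank_bot, add_zero] at h
    omega
  -- `C` is `GL`-stable
  have hIstab : ∀ (b : GL σ ℂ) {m : MvPolynomial (DegIdx σ n) ℂ}, m ∈ Mi → coordSubst n b m ∈ Mi := by
    intro b m hm
    refine ⟨?_, ?_⟩
    · have := orbitVanishingIdeal_le_comap_coordSubst f n b hm.1
      exact this
    · exact (mem_homogeneousSubmodule d _).mpr (isHomogeneous_coordSubst b ((mem_homogeneousSubmodule d m).mp hm.2))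
  have hCstab : ∀ (b : GL σ ℂ) {y : MvPolynomial (DegIdx σ n) ℂ}, y ∈ C → coordSubst n b y ∈ C := by
    intro b y hy
    obtain ⟨hySd, hyC⟩ := hCmem.mp hy
    have hyhom : y.IsHomogeneous d := (mem_homogeneousSubmodule d y).mp hySd
    refine hCmem.mpr ⟨(mem_homogeneousSubmodule d _).mpr (isHomogeneous_coordSubst b hyhom), fun m hm => ?_⟩
    obtain ⟨g, rfl⟩ := tp_exists_glReindexTransposeInv ρ b
    obtain ⟨gH, hgH⟩ := tp_exists_conjTranspose g
    have hg : (g : Matrix (Fin Mσ) (Fin Mσ) ℂ) = (gH : Matrix (Fin Mσ) (Fin Mσ) ℂ)ᴴ := by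
      rw [hgH, Matrix.conjTranspose_conjTranspose]
    have hmhom : m.IsHomogeneous d := (mem_homogeneousSubmodule d m).mp hm.2
    have hadj := tp_form_adjoint ρ (g := gH) (g' := g) hg hmhom hyhom
    rw [← hB, ← hB] at hadj
    rw [← hadj]
    exact hyC _ (hIstab _ hm)
  -- the decomposition of `H`: `H ≤ (H ⊓ Mi) ⊔ (H ⊓ C)`
  have hdecomp : H ≤ (H ⊓ Mi) ⊔ (H ⊓ C) := by
    intro h hh
    have hhSd : h ∈ Sd := hh.2
    rw [← hsup] at hhSd
    obtain ⟨m, hm, c, hc, hmc⟩ := Submodule.mem_sup.mp hhSd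
    -- `m` is a highest-weight vector
    have hmHW : m ∈ HW := by
      intro b hb
      have hhb : coordSubst n b h = weightChar χ b • h := by
        have := hh.1 b hb; rwa [coordRep_apply] at this
      have hbm : coordSubst n b m ∈ Mi := hIstab b hm
      have hbc : coordSubst n b c ∈ C := hCstab b hc
      -- `(b m - χ b • m) = -(b c - χ b • c)` lies in `Mi ⊓ C = ⊥`
      have hsum' : (coordSubst n b m - weightChar χ b • m) + (coordSubst n b c - weightChar χ b • c) = 0 := by
        have : coordSubst n b m + coordSubst n b c = weightChar χ b • m + weightChar χ b • c := by
          rw [← map_add, hmc, hhb, ← smul_add, hmc]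
        rw [sub_add_sub_comm, this, sub_self]
      have hx : coordSubst n b m - weightChar χ b • m ∈ Mi := Mi.sub_mem hbm (Mi.smul_mem _ hm)
      have hy : coordSubst n b c - weightChar χ b • c ∈ C := C.sub_mem hbc (C.smul_mem _ hc)
      have hx' : coordSubst n b m - weightChar χ b • m ∈ Mi ⊓ C := by
        refine ⟨hx, ?_⟩
        have : coordSubst n b m - weightChar χ b • m = -(coordSubst n b c - weightChar χ b • c) :=
          eq_neg_of_add_eq_zero_left hsum'
        rw [this]
        exact C.neg_mem hy
      rw [hMiC, Submodule.mem_bot, sub_eq_zero] at hx'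
      rw [coordRep_apply, hx']
    have hmH : m ∈ H := ⟨hmHW, hMile hm⟩
    have hcH : c ∈ H := by
      have : c = h - m := by rw [← hmc]; ring
      rw [this]
      exact H.sub_mem hh hmH
    rw [← hmc]
    exact Submodule.add_mem_sup ⟨hmH, hm⟩ ⟨hcH, hc⟩
  have hdimH : Module.finrank ℂ ↥H ≤ Module.finrank ℂ ↥(H ⊓ Mi) + Module.finrank ℂ ↥(H ⊓ C) := by
    haveI : FiniteDimensional ℂ ↥(H ⊓ Mi ⊔ H ⊓ C) :=
      Submodule.finiteDimensional_of_le ((sup_le inf_le_left inf_le_left).trans hHle)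
    exact (Submodule.finrank_mono hdecomp).trans (Submodule.finrank_add_le_finrank_add_finrank _ _)
  -- the twisted part meets `C` trivially
  have htwC : (H ⊓ I.comap tw.toLinearMap) ⊓ (H ⊓ C) = ⊥ := by
    rw [Submodule.eq_bot_iff]
    rintro y ⟨⟨hyH, hytw⟩, _, hyC⟩
    have hySd : y ∈ Sd := hHle hyH
    have htwy : tw y ∈ Mi := by
      refine ⟨hytw, ?_⟩
      exact (mem_homogeneousSubmodule d _).mpr
        (tp_isHomogeneous_twist _ ((mem_homogeneousSubmodule d y).mp hySd))
    exact hpos y hySd ((hCmem.mp hyC).2 _ htwy)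
  have hdim2 : Module.finrank ℂ ↥(H ⊓ I.comap tw.toLinearMap) + Module.finrank ℂ ↥(H ⊓ C) ≤
      Module.finrank ℂ ↥H := by
    haveI : FiniteDimensional ℂ ↥(H ⊓ I.comap tw.toLinearMap) :=
      Submodule.finiteDimensional_of_le (inf_le_left.trans hHle)
    haveI : FiniteDimensional ℂ ↥(H ⊓ C) := Submodule.finiteDimensional_of_le (inf_le_left.trans hHle)
    have h := Submodule.finrank_sup_add_finrank_inf_eq (H ⊓ I.comap tw.toLinearMap) (H ⊓ C)
    rw [htwC, finrank_bot, add_zero] at h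
    rw [← h]
    haveI : FiniteDimensional ℂ ↥(H ⊓ Submodule.comap tw.toLinearMap I ⊔ H ⊓ C) :=
      Submodule.finiteDimensional_of_le ((sup_le inf_le_left inf_le_left).trans hHle)
    exact Submodule.finrank_mono (sup_le inf_le_left inf_le_left)
  -- `H ⊓ Mi = H ⊓ I`
  have hHMi : H ⊓ Mi = H ⊓ I := by
    apply le_antisymm
    · exact fun y hy => ⟨hy.1, hy.2.1⟩
    · exact fun y hy => ⟨hy.1, hy.2, hHle hy.1⟩
  rw [hHMi] at hdimH
  omega

end

end Summit.ValiantsHypothesis.ValiantsHypothesis.Theorems.ValuativeFlip
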